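import Summits.Ventures.Crystal3D.Theorems.StickyWulffConstantPolycrystalWulffBoundGapShifts
import Summits.Ventures.Crystal3D.Theorems.StickyWulffConstantPolycrystalWulffBoundTwinSectionShiftSlabHolds

/-!
# `PolycrystalWulffBound`, line `PolyDensity`: ingredients for gap feasibility INSIDE BASAL SLABS
# (conditional quantiles and the slab-restricted twin shift in `hshift` form; crux `stmt-Ventures-19482`)

Route `StickyWulffConstant` of the venture `Summits/Ventures/Crystal3D`, second prover lane (poly-p2,
gen 14).  The reduction `rung_gapCells` needs, per cell, a target `W(A_j) ∩ ⋂ half-spaces` of prescribed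
volume.  For single-axis textures cut by basal planes into slabs whose in-slab wall graphs are forests,
the targets are built INSIDE the slab bodies `K = W(A) ∩ {⟪y, m⟫ ∈ I}` (all of the same volume for
co-axial frames); this file supplies the two ingredients (memo P-GAP-g14 §6.7):
* `exists_capHeight_eq_of_isCompact` — exact conditional quantiles: for a compact `B ⊆ B̄(0,R)` of volume
  `M`, a unit `n` and `u ∈ [0,1]` there is `s` with `|B ∩ {s < ⟪y, n⟫}| = M·u`;
* `capShift_slab_of_coaxial` — the slab-restricted shift in the form of a gap hypothesis: for a co-axial
  pair `Ax m P C`, a horizontal bond `u` of `C`'s lattice and a unit `w ⊥ m, u`, every height set `I`,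
  every `ν` and `s`:
  `|W(P) ∩ {⟪y,m⟫ ∈ I} ∩ {s + (2/√6)|⟪w,ν⟫| < ⟪y,ν⟫}| ≤ |W(C) ∩ {⟪y,m⟫ ∈ I} ∩ {s < ⟪y,ν⟫}|`
  (from `cruxWulffBody_twin_slab_cdf_le` via `ν ↦ −ν`; best of the three `w`: `(1/√6)·sin∠(ν,m) ≤ ½·sin∠`).
So in the gap engine every in-slab twin wall chooses ITS OWN `w` — no azimuth test, no `0.5443`.
WHAT THIS IS NOT: the slab-forest rung itself (next file); the crux is not claimed.
-/

noncomputable section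

open scoped BigOperators InnerProductSpace ENNReal Pointwise
open MeasureTheory Set

namespace Summit.Ventures.Crystal3D.Theorems

open Summit.Ventures.Crystal3D.Cruxes.TextureLiminf.TexShadow (E3)
open Literature.MathematicalPhysics.StatisticalMechanics (fccStacking barlowStacking IsHaggSeq)

/-- **Exact conditional quantiles.**  For a compact `B ⊆ B̄(0, R)` of volume `M`, a unit vector `n` and
`u ∈ [0, 1]` there is a level `s`, `|s| ≤ R + 1`, with `|B ∩ {s < ⟪y, n⟫}| = M·u`. -/
theorem exists_capHeight_eq_of_isCompact (n : E3) (hn : ‖n‖ = 1) (B : Set E3) (hBc : IsCompact B)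
    {R : ℝ} (hR : 0 ≤ R) (hBR : B ⊆ Metric.closedBall 0 R) {M : ℝ} (hM0 : 0 ≤ M)
    (hBM : volume B = ENNReal.ofReal M) {u : ℝ} (hu0 : 0 ≤ u) (hu1 : u ≤ 1) :
    ∃ s : ℝ, |s| ≤ R + 1 ∧ volume (B ∩ {y : E3 | s < ⟪y, n⟫_ℝ}) = ENNReal.ofReal (M * u) := by
  have hBm : MeasurableSet B := hBc.isClosed.measurableSet
  obtain ⟨q, hqR, hq⟩ := exists_quantile_of_isCompact n hn B hBc hR hBR hM0 hBM
  refine ⟨q (1 - u), hqR _, le_antisymm ?_ ?_⟩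
  · -- upper bound: the complementary lower part has volume ≥ M(1 − u)
    have h := hq 0 (1 - u) le_rfl (by linarith) (by linarith)
    rw [show (1 - u - 0) * M = M * (1 - u) by ring] at h
    have hlow : ENNReal.ofReal (M * (1 - u)) ≤ volume (B ∩ {y | ⟪y, n⟫_ℝ < q (1 - u)}) :=
      h.trans (measure_mono fun y hy => ⟨hy.1, hy.2.2⟩)
    have hgt_m : MeasurableSet {y : E3 | q (1 - u) < ⟪y, n⟫_ℝ} :=
      (isOpen_lt continuous_const (continuous_id.inner continuous_const)).measurableSet
    have hdisj : Disjoint (B ∩ {y | ⟪y, n⟫_ℝ < q (1 - u)}) (B ∩ {y | q (1 - u) < ⟪y, n⟫_ℝ}) := by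
      rw [Set.disjoint_left]
      rintro y ⟨-, hy1⟩ ⟨-, hy2⟩
      rw [mem_setOf_eq] at hy1 hy2
      exact lt_irrefl _ (lt_trans hy1 hy2)
    have hle : volume (B ∩ {y | ⟪y, n⟫_ℝ < q (1 - u)}) + volume (B ∩ {y | q (1 - u) < ⟪y, n⟫_ℝ}) ≤
        ENNReal.ofReal M := by
      rw [← measure_union hdisj (hBm.inter hgt_m), ← hBM]
      exact measure_mono (union_subset inter_subset_left inter_subset_left)
    have hfin1 : volume (B ∩ {y | ⟪y, n⟫_ℝ < q (1 - u)}) ≠ ⊤ :=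
      (lt_of_le_of_lt (measure_mono inter_subset_left) hBc.measure_lt_top).ne
    have hfin2 : volume (B ∩ {y | q (1 - u) < ⟪y, n⟫_ℝ}) ≠ ⊤ :=
      (lt_of_le_of_lt (measure_mono inter_subset_left) hBc.measure_lt_top).ne
    rw [← ENNReal.ofReal_toReal hfin2]
    apply ENNReal.ofReal_le_ofReal
    have h1 := ENNReal.toReal_mono ENNReal.ofReal_ne_top hle
    rw [ENNReal.toReal_add hfin1 hfin2, ENNReal.toReal_ofReal hM0] at h1
    have h2 := ENNReal.toReal_mono hfin1 hlow
    rw [ENNReal.toReal_ofReal (by nlinarith)] at h2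
    nlinarith
  · -- lower bound: the upper part has volume ≥ M u
    have h := hq (1 - u) 1 (by linarith) (by linarith) le_rfl
    rw [show (1 - (1 - u)) * M = M * u by ring] at h
    exact h.trans (measure_mono fun y hy => ⟨hy.1, hy.2.1⟩)

/-- **Slab-restricted cap shift across a co-axial wall** (gap form): `Ax m P C`, a horizontal unit bond
`u` of `C`'s lattice, a unit `w ⊥ m, u`; then for every height set `I`, every `ν` and `s`,
`|W(P) ∩ {⟪y,m⟫ ∈ I} ∩ {s + (2/√6)|⟪w,ν⟫| < ⟪y,ν⟫}| ≤ |W(C) ∩ {⟪y,m⟫ ∈ I} ∩ {s < ⟪y,ν⟫}|`. -/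
theorem capShift_slab_of_coaxial {m : E3} {P C : E3 ≃ₗᵢ[ℝ] E3}
    (h : ∃ (L : E3 ≃ₗᵢ[ℝ] E3) (s₁ s₂ : E3) (σ σ' : ℤ → ℤ), IsHaggSeq σ ∧ IsHaggSeq σ' ∧
      L (EuclideanSpace.single (2 : Fin 3) (1 : ℝ)) = m ∧
      P '' fccStacking 1 (Real.sqrt (2 / 3)) ⊆
        (fun q => L q + s₁) '' barlowStacking 1 (Real.sqrt (2 / 3)) σ ∧
      C '' fccStacking 1 (Real.sqrt (2 / 3)) ⊆
        (fun q => L q + s₂) '' barlowStacking 1 (Real.sqrt (2 / 3)) σ')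
    {u w : E3} (hu : u ∈ C '' fccStacking 1 (Real.sqrt (2 / 3))) (hu1 : ‖u‖ = 1) (hum : ⟪u, m⟫_ℝ = 0)
    (hw : ‖w‖ = 1) (hwm : ⟪w, m⟫_ℝ = 0) (hwu : ⟪w, u⟫_ℝ = 0)
    {I : Set ℝ} (hI : MeasurableSet I) (ν : E3) (s : ℝ) :
    volume ({y : E3 | ∀ ν : E3, ⟪y, ν⟫_ℝ ≤ Real.sqrt 2 / 4 *
        ∑ᶠ w ∈ {w | w ∈ fccStacking 1 (Real.sqrt (2 / 3)) ∧ ‖w‖ = 1}, |⟪w, P.symm ν⟫_ℝ|} ∩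
        {y : E3 | ⟪y, m⟫_ℝ ∈ I} ∩ {y : E3 | s + 2 / Real.sqrt 6 * |⟪w, ν⟫_ℝ| < ⟪y, ν⟫_ℝ}) ≤
      volume ({y : E3 | ∀ ν : E3, ⟪y, ν⟫_ℝ ≤ Real.sqrt 2 / 4 *
        ∑ᶠ w ∈ {w | w ∈ fccStacking 1 (Real.sqrt (2 / 3)) ∧ ‖w‖ = 1}, |⟪w, C.symm ν⟫_ℝ|} ∩
        {y : E3 | ⟪y, m⟫_ℝ ∈ I} ∩ {y : E3 | s < ⟪y, ν⟫_ℝ}) := by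
  set θ : ℝ := 2 / Real.sqrt 6 * |⟪w, ν⟫_ℝ| with hθ
  -- slab TSS for the pair `(C, P)` along `−ν` at the level `t = −s − θ`
  have h1 := cruxWulffBody_twin_slab_cdf_le (cruxAx_symm h) hu hu1 hum hw hwm hwu hI (-ν) (-s - θ)
  have hθ' : 2 / Real.sqrt 6 * |⟪w, -ν⟫_ℝ| = θ := by rw [hθ, inner_neg_right, abs_neg]
  rw [hθ'] at h1
  have hP : {y : E3 | ⟪y, -ν⟫_ℝ < -s - θ} = {y : E3 | s + θ < ⟪y, ν⟫_ℝ} := by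
    ext y; simp only [mem_setOf_eq, inner_neg_right]; constructor <;> intro hy <;> linarith
  have hC : {y : E3 | ⟪y, -ν⟫_ℝ < -s - θ + θ} = {y : E3 | s < ⟪y, ν⟫_ℝ} := by
    ext y; simp only [mem_setOf_eq, inner_neg_right]; constructor <;> intro hy <;> linarith
  rw [hP, hC] at h1
  exact h1

end Summit.Ventures.Crystal3D.Theorems

end
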